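import Summits.RiemannHypothesis.RiemannHypothesis.Theorems.Splittings.BombieriFozNoDep
import Literature.Barriers.RiemannHypothesis.LindelofBacklundProofs
import Literature.Barriers.RiemannHypothesis.LindelofBacklundMomentsProofs

/-!
# Splittings — FOZ ⟹ LINDELÖF: the Lindelöf family sits below the head FOZ of every FOZ-headed splitting
# (SPLIT-x-wuc gen 4 §10, wuc census in kernel; zero-definition raw form, RH-free)

Cell rh-split (brief sha16 f79c5f09d8bcb036), seat rh-split-x-wuc g4, card `run/shared/lean/pub/rh-split/cards/SPLIT-x-wuc.md` §10;
carved VERBATIM from §6 of `HOME/rh-split-x-wuc/SplitXWucG4.lean` (sha16 914a11412a5ad93c; the seat's proposed file (B)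
`FozLindelof.lean`, zero defs), referee rh-split-ref g2 CONTENT PRE-FILE PASS in advance (02:53Z: statements
`backlundZeroCondition_of_cofiniteCriticalLine`, `lindelof_of_cofiniteCriticalLine`, `criticalMoments_of_cofiniteCriticalLine`,
`foz_and_lindelof_iff_foz`), filed by rh-split-typer-2 g3 on the lead's queue 03:10Z item (3) (cross family).

Content (RH-free, GIVEN FOZ = `Theses.RuelleBand.CofiniteCriticalLine`): above the height of the last off-line zero
(`BombieriFozNoDep.exists_zdTail_of_cofiniteCriticalLine`) the boxes `σ ≤ Re ρ`, `σ > ½` gain nothing, so Backlund's zero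
condition holds (`backlundZeroCondition_of_cofiniteCriticalLine`); by the tree's PROVED Backlund–Littlewood criterion
(`Titchmarsh1986_thm13_5_holds`) FOZ ⟹ LH (`lindelof_of_cofiniteCriticalLine`), and by the PROVED Hardy–Littlewood moment
criterion (`Titchmarsh1986_thm13_2_holds`) FOZ ⟹ every moment bound `O(T^ε)` (`criticalMoments_of_cofiniteCriticalLine`); hence
`FOZ ∧ LH ⟺ FOZ` (`foz_and_lindelof_iff_foz`): LH and the moment bounds are VACUOUS as tails of a FOZ-headed splitting (the X4
columns LH / moments).  Dedup note: the tree's `AsymptoticCriticalLine.Negative.lindelof_of_acl'` derives LH from the weaker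
RuelleBand rung ACL; the statements here are the FOZ-hypothesis forms used by the x-wuc census.  Referee label (02:52Z verdict on
§10): DELIVERABLE, class (x, wuc) UNCHANGED.

HONEST LABEL: «SPLITTING SEARCH over kernel-typed RH-EQUIVALENCES; a splitting A ∧ B ⟹ RH is CONDITIONAL bookkeeping
unless A and B are both proved; nothing here bears on the truth of RH.»
-/

set_option linter.dupNamespace false

noncomputable section

open scoped Classical
open Set Filter Topology Complex

namespace Summit.RiemannHypothesis.RiemannHypothesis.Theorems.Splittings.FozLindelof

open Literature.NumberTheory.LFunctions
open Literature.NumberTheory.DiophantineGeometry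
open Summit.RiemannHypothesis.RiemannHypothesis.Theses.RuelleBand
open Summit.RiemannHypothesis.RiemannHypothesis.Theorems.Splittings.BombieriFozNoDep
open Literature.Barriers.RiemannHypothesis

/-! ## §6 wuc census in kernel: the Lindelöf family is already below the head FOZ (RH-free) -/

/-- **FOZ ⟹ Backlund's zero condition** (RH-free): above the height `H` of the last off-line zero the boxes
`σ ≤ Re ρ`, `σ > ½` gain nothing, so `N(σ, T) ≤ N(σ, H)` and `N(σ, T+1) − N(σ, T) = O(1) = o(log T)`.
[new-but-trivial; rh-split x-wuc g4 wuc census] -/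
theorem backlundZeroCondition_of_cofiniteCriticalLine (h : CofiniteCriticalLine) : BacklundZeroCondition := by
  obtain ⟨H, hT⟩ := exists_zdTail_of_cofiniteCriticalLine h
  intro σ hσ
  have hsub : ∀ T : ℝ, zetaZeroBox σ T ⊆ zetaZeroBox σ H := by
    rintro T ρ ⟨h0, h1, h2, h3, h4⟩
    refine ⟨h0, h1, h2, h3, ?_⟩
    by_contra hHρ
    have := hT ρ h0 h3 (lt_of_not_ge hHρ)
    linarith
  have hbd : ∀ T : ℝ, (zetaZeroCountRe σ T : ℝ) ≤ zetaZeroCountRe σ H := fun T ↦ by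
    exact_mod_cast zetaZeroCountRe_le_of_subset (hsub T)
  have hO : (fun T : ℝ ↦ ((zetaZeroCountRe σ (T + 1) : ℝ) - zetaZeroCountRe σ T)) =O[atTop]
      (fun _ : ℝ ↦ (1 : ℝ)) := by
    refine Asymptotics.IsBigO.of_bound (zetaZeroCountRe σ H : ℝ) (Eventually.of_forall fun T ↦ ?_)
    rw [norm_one, mul_one, Real.norm_eq_abs, abs_sub_le_iff]
    have h1 := hbd (T + 1)
    have h2 := hbd T
    have h3 : (0 : ℝ) ≤ zetaZeroCountRe σ T := Nat.cast_nonneg _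
    have h4 : (0 : ℝ) ≤ zetaZeroCountRe σ (T + 1) := Nat.cast_nonneg _
    constructor <;> linarith
  have hlog : (fun _ : ℝ ↦ (1 : ℝ)) =o[atTop] Real.log :=
    Asymptotics.isLittleO_const_left.2 (Or.inr (tendsto_norm_atTop_atTop.comp Real.tendsto_log_atTop))
  exact hO.trans_isLittleO hlog

/-- **FOZ ⟹ the Lindelöf hypothesis** (RH-free, through the tree's PROVED Backlund–Littlewood criterion, Titchmarsh
Theorem 13.5): the textbook «weakest famous unknown consequence of RH» lies BELOW the head of every FOZ-headed
splitting, so `FOZ ∧ LH ⟺ FOZ` and LH can never be the tail of one. [new-combination; rh-split x-wuc g4 wuc census,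
cite: Titchmarsh1986, Theorem 13.5] -/
theorem lindelof_of_cofiniteCriticalLine (h : CofiniteCriticalLine) : LindelofHypothesis :=
  Titchmarsh1986_thm13_5_holds.2 (backlundZeroCondition_of_cofiniteCriticalLine h)

/-- **FOZ ⟹ every moment bound** `(1/T)∫₁^T |ζ(½+it)|^{2k} dt = O(T^ε)` (`k ≥ 1`, `ε > 0`), RH-free, through the
tree's PROVED Hardy–Littlewood criterion (Titchmarsh Theorem 13.2): the «moments» complement of the X4 table is
below the FOZ head as well. [new-combination; rh-split x-wuc g4 wuc census, cite: Titchmarsh1986, Theorem 13.2] -/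
theorem criticalMoments_of_cofiniteCriticalLine (h : CofiniteCriticalLine) {k : ℕ} (hk : 1 ≤ k) {ε : ℝ}
    (hε : 0 < ε) : (criticalMoment k) =O[atTop] fun T : ℝ ↦ T ^ ε :=
  Titchmarsh1986_thm13_2_holds.1 (lindelof_of_cofiniteCriticalLine h) k hk ε hε

/-- Hence a FOZ-headed «splitting» with any of these tails is the bare implication `FOZ → RH` (the X4 columns LH /
moments are VACUOUS as tails, by kernel logic). [new-but-trivial] -/
theorem foz_and_lindelof_iff_foz : (CofiniteCriticalLine ∧ LindelofHypothesis) ↔ CofiniteCriticalLine :=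
  ⟨fun h ↦ h.1, fun h ↦ ⟨h, lindelof_of_cofiniteCriticalLine h⟩⟩

end Summit.RiemannHypothesis.RiemannHypothesis.Theorems.Splittings.FozLindelof

end
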